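import Literature.NumberTheory.LFunctions.ConreyIwaniec2002
import Literature.NumberTheory.LFunctions.ClassGroupCharacterTwist
import Literature.NumberTheory.LFunctions.RamanujanDivisorSquare
import Mathlib.MeasureTheory.Integral.IntervalIntegral.Basic
import Mathlib.Analysis.SpecialFunctions.Gamma.Basic
import HarnessLib

/-!
# Conrey–Iwaniec (2002), §§6–9: the `t`-averaged zero-spacing mechanism behind Proposition 9.2
# (Corollary 6.3, Proposition 6.4, the root-number quotient `x(s)` of §7, Proposition 8.1,
# Proposition 9.1)

LABEL (cell `landau-siegel`, sub-cell §C literature harvest, rung F-S3; tag **E*-ℓ**: zero-spacing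
input of the Conrey–Iwaniec type). STATEMENT LAYER: four NAMED FACTS (D-0014; `def … : Prop`,
theorem-in-print, NOT proved here) — Corollary 6.3, Proposition 6.4, Proposition 8.1,
Proposition 9.1 of Conrey–Iwaniec — plus the DEFINITIONS they need (`X(s)`, `x(s)`, `N(s)`, `M(s)`,
`ℒ(Y)`, the dyadic point sets of §8, the cut-off class (6.38)) and a little PROVED bookkeeping
(`|X(½ + it)| = 1`, (7.26); dyadic point sets are point sets). The file sits UPSTREAM of the tree's
`conreyIwaniec2002_proposition92` (`ConreyIwaniec2002MeanValues.lean`, the corpus' fact-list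
boundary): Conrey–Iwaniec derive (9.12) from Proposition 8.1 and Proposition 9.1 by Cauchy's
inequality ((9.9)–(9.11)); Propositions 8.1/9.1 rest on Proposition 6.4 and Corollary 6.3, which
rest on Theorem 6.1 and §§2–5 (automorphic forms, summation formulas, convolution sums — Theorem
4.1/4.3/4.4, Lemma 5.3, Proposition 5.4), NOT typed here (index only).

WHY THESE FOUR (what they say, informally). Under the standing data of §7 the divided difference
`ℓ(s) = (L(s) − L(s′))/(s − s′)` of a class group `L`-function of `ℚ(√−q)` at two critical points
is, ON AVERAGE over any `1`-spaced set of points `s = ½ + it`, `T < t ≤ 2T`, approximated by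
`x(s)·N̄(s)` (Proposition 8.1) and `ℓ(s)M̄(s)` approximates `x(s) = (X(s) − X(s′))/(s − s′)`
(Proposition 9.1), with defects controlled by `ℒ(T) = L(1,χ)(L(1,χ) log T + |L′(1,χ)|)` — small
exactly when `L(1,χ)` is small. Since `|x(s)| = 2|sin((t−t′)log tQ)/(t−t′)| + O(1/t)` (Lemma 7.5),
pairs of critical zeros `s, s′` (where `ℓ(s) = 0`) are then forced towards the lattice
`(t − t′) log(tQ) ∈ πℤ`: the `t`-AVERAGED form of the Deuring–Heilbronn "picket fence", with
ABSOLUTE BUT UNEVALUATED implied constants ("the implied constant is absolute", (8.10), (9.7),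
(6.52)). This is the printed zero-spacing input of the Conrey–Iwaniec route (programme tag E*-ℓ;
the constant `c` of the cell's ESTAR row E*-ℓ is NOT printed here or anywhere — these facts carry
`∃ C` only).

## What the source prints (held text `paper:arxiv-math_0111012`, corpus-tex, chunks p0014–p0020,
read 2026-08-26)

B. Conrey, H. Iwaniec, *Spacing of zeros of Hecke `L`-functions and the class number problem*,
Acta Arith. 103 (2002) 259–312 [ConreyIwaniec2002].

**§6, (6.42)–(6.50)** (p0016:L75–160). For `K = ℚ(√−q)` with real primitive character `χ` mod
`q`, `τ(n,χ) = Σ_{d∣n} χ(d)` are the coefficients of `ζ_K(s) = ζ(s)L(s,χ)` ((6.42)–(6.43)).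

> **Corollary 6.3** (p0016:L154–160). For `Y ≥ 2X ≥ 2` we have
> `Σ_{X ≤ n ≤ Y} τ²(n,χ) n^{−1} ≪ ℒ(Y) log(Y/X) + (q/X)^{1/2}` (6.49), where
> `ℒ(Y) = L(1,χ)(L(1,χ) log Y + |L′(1,χ)|)` (6.50).

(Derived from (6.48), whose error `O((q/X)^{1/2})` comes from `R_K(s) ≪ q^{1/2}|s|^{5/6}` on
`Re s ≥ ½`; the implied constant is absolute — Proposition 6.4: "the implied constant is absolute".)

> **(6.38)** (p0016:L40–47). `y^ν |a^{(ν)}(y)| ≤ (1 + y/Y + T/y)^{−4}` if `ν = 0,1,2`, where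
> `T ≤ Y ≤ T⁸` (`a(y)` "a `𝒞²` class function on `ℝ⁺`", Theorem 6.1).

> **Proposition 6.4** (p0017:L2–14). Let `λ(n)` be the coefficients of an automorphic form given
> by Hecke characters of the imaginary quadratic field `K = ℚ(√−q)` of discriminant `−q`. Let
> `a(y)` be a function satisfying (6.38) with `Y = qT` and `T ≥ K^{32} q^{65}`. Then
> `∫_T^{2T} |Σ_n a(n)λ(n) n^{−1/2−it}|² dt ≪ T ℒ(T) log q` (6.52)
> where `ℒ(T)` is defined by (6.50) and the implied constant is absolute.

(`K^{32}` = the weight `k` of the form to the 32nd power: the error `B^{1/2}T^{15/16}` of (6.41)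
with `B = k⁴q⁶` for cusp forms of weight `k` (Theorem 4.3), `B = q⁶` for the weight-one theta
series of class group characters (Theorem 4.4, p0015:L37–41). §8 (p0018:L131–135): "For the
time being we assume that `T ≥ q^{65}` to comply with the condition of Proposition 6.4" — the
class-group-character case, `k = 1`, which is the case typed here.)

**§7, standing data for §§7–10** (p0017:L17–36): "`K = ℚ(√−q)` where `−q` is the discriminant.
We assume that `q` is odd and `q > 4`, so `q ≡ 3 (mod 4)` and `q` is squarefree. Fix
`ψ ∈ Ĉℓ(K)` and put `λ(n) = Σ_{N𝔞 = n} ψ(𝔞)` (7.1) … `L(s) = Σ λ(n) n^{−s}` (7.3) …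
`Λ(s) = Q^s Γ(s) L(s)` with `Q = √q/2π` (7.6)". Proposition 7.1 (7.12)–(7.13):
`X(s) = Q^{1−2s} Γ(1−s)/Γ(s)`. (7.19)–(7.20): `ℓ(s) = (L(s) − L(s′))/(s − s′)` ("if `s = s′`,
then `ℓ(s) = L′(s)`"), `x(s) = (X(s) − X(s′))/(s − s′)`. Before (7.26) (p0018:L83–88): "`|X(s)| = 1`
for `Re s = ½`". Lemma 7.5 (7.28): `|x(s)| = 2|sin((t−t′)log tQ)/(t−t′)| + O(1/t)` for `t, t′ ≥ 1`.

**§8** (p0018:L112–130): points `s_r = ½ + it_r`, `r = 1,…,R` (8.1) with `T < t₁ < … < t_R ≤ 2T`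
(8.2), `t_{r+1} − t_r ≥ 1` (8.3), "To each point `s_r` we associate a point `s′_r = ½ + it′_r`"
(8.4) ("The companion `s′_r` to `s_r` may not be in `S(T)` … We may have `s_r = s′_r`").
`N(s) = Σ_{n ≤ q⁴} λ(n) n^{−s}` (8.8).

> **Proposition 8.1** (p0019:L73–87). Let `S(T)` be a set of points satisfying (8.1)–(8.3) with
> `T ≥ 2`. Put `D(T) = Σ_s |ℓ(s) − x(s)N̄(s)|²` where `s` runs over `S(T)` (recall the settings
> (7.19), (7.20), (8.8)). We have `D(T) ≪ T(log q)^7 + T ℒ(T)(log T)^4` (8.10) where `ℒ(T)` is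
> defined by (6.50), the implied constant being absolute.

**§9** (p0019:L94–p0020:L9): `L^{−1}(s) = Σ_m λ*(m) m^{−s}`, `λ*(m) = Σ_{N𝔞 = m} μ(𝔞)ψ(𝔞)` (9.3);
`M(s) = Σ_{m ≤ q⁴} λ*(m) m^{−s}` (9.5); `E(T) = Σ_s |ℓ(s)M̄(s) − x(s)|` (9.6).

> **Proposition 9.1** (p0020:L38–44). Let `S(T)` be a set of points satisfying (8.1)–(8.3) with
> `T ≥ 2`. Then `E(T) ≪ T(log q)^6 + T ℒ(T)^{1/2}(log T)²(log q)^{5/2}` (9.7) where the implied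
> constant is absolute.

"Assuming that `L(1,χ)` is relatively small Proposition 9.1 asserts that `ℓ(s)M̄(s)` approximates
to `x(s)` at almost all points `s` in any well-spaced set `S(T)`. This assertion is particularly
interesting if `ℓ(s)` … is very small, because it implies that `x(s)` … is also quite small."
(p0020:L45–50.)

## Lean rendering / design choices (audit notes for ls-lit-ref)

* Dictionary = the tree's Conrey–Iwaniec files (`ConreyIwaniec2002.lean`): `χ : DirichletCharacter
  ℂ q` primitive, quadratic, odd, `4 < q` (⟺ `−q` fundamental), §7's "`q` odd" as `Odd q` EXPLICIT
  on Propositions 6.4/8.1/9.1 (Corollary 6.3 lives in §6, before the parity restriction, and uses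
  only `ζ_K = ζ·L(·,χ)`: no `Odd q` there); `K : Type` with `finrank ℚ K = 2`, `discr K = −q`;
  `ψ : ClassGroup (𝓞 K) →* ℂˣ`; `L(s) = classGroupLFunction K ψ`; `ℓ(s)` =
  `ConreyIwaniec2002.dividedDifference` (value `L′(s)` at `s′ = s`).
* `λ(n)` (7.1) = the tree's `NumberField.twistCount K (classGroupCharIdealHom ψ) n`
  (`= Σ_{N𝔞 = n} ψ([𝔞])`; its `L`-series is `classGroupLFunction` on `Re s > 1`,
  `LSeries_twistCount_classGroupCharIdealHom`); `λ*(m)` (9.3) = `NumberField.twistMoebius`;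
  `τ(n,χ)` = the tree's `divisorSumChar χ n`. Cited, not re-declared.
* `X(s)` (7.13) = `afeX q s` with `Q = condQ q = √q/(2π)`; `x(s)` (7.20) =
  `dividedDifference (afeX q) s s′` (`xQuot`), with the SAME coincident-companion convention as
  `ℓ(s)` (the paper differentiates both quotients; Lemma 7.5's main term is continuous at `t′ = t`).
* `N(s)`, `M(s)`: finite sums over `1 ≤ n ≤ q⁴` (`shortLSum`, `shortInvSum`); `N̄(s)`, `M̄(s)` =
  complex conjugates (`starRingEnd ℂ`).
* Point sets of §8: `IsDyadicPointSet S T` — a `Finset ℝ` in `(T, 2T]`, pairwise `1`-separated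
  (for a finite set of reals this is (8.2)–(8.3)); companions `t′ : ℝ → ℝ` UNRESTRICTED, as printed
  (8.4) and as in the tree's Proposition 9.2. `IsDyadicPointSet.isPointSet`: such a set is an
  `IsPointSet S (2T)` of Proposition 10.1 when `T ≥ 2`.
* (6.38): `IsCutoff a T Y` — `a : ℝ → ℂ` of class `𝒞²` on `(0, ∞)` (`ContDiffOn`) with
  `y^ν ‖a^{(ν)}(y)‖ ≤ (1 + y/Y + T/y)^{−4}` for `ν ≤ 2`, `y > 0` (`iteratedDeriv`; on the open
  half-line the within-derivative is the derivative). The printed side condition `T ≤ Y ≤ T⁸` is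
  automatic at `Y = qT`, `T ≥ q^{65}` and is not repeated. The series `Σ_n a(n)λ(n)n^{−1/2−it}` is
  Mathlib's `LSeries (fun n ↦ a n · λ(n)) (½ + it)` (the `n = 0` term is `0` by definition; the
  series converges absolutely since `a(n) ≤ (Y/n)⁴`).
* Proposition 6.4 is typed in the CASE USED IN §§8–9: `λ = λ_ψ` for a class group character
  (weight-one theta series), threshold `T ≥ q^{65}`.
  `-- TODO(general form): Hecke Grössencharacters of weight k ("automorphic form given by Hecke
  characters"), threshold T ≥ k^{32} q^{65}.`
* "`≪` … the implied constant is absolute" ⟹ ONE `∃ C > 0` OUTERMOST in each fact (before `q`,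
  `χ`, `K`, `ψ`, `T`, the points). Real exponents: `(log q)^{5/2}` is `Real.rpow`, `ℒ(T)^{1/2}` and
  `(q/X)^{1/2}` are `Real.sqrt`; `L(1,χ)`, `|L′(1,χ)|` are `‖χ.LFunction 1‖`,
  `‖deriv χ.LFunction 1‖` (`L(1,χ) > 0` for real `χ`, so the norm is the value).
* Guards `2 ≤ T` (printed), `1 ≤ X` (printed "`2X ≥ 2`").

WHAT THIS IS NOT: no claim about Siegel zeros, about the spacing of zeros of any `L(s,ψ)`, or
about the constant `c` of the programme's E*-ℓ lever; typing printed mean-value theorems is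
transcription. «The programme SEARCHES and TYPES; no claim about Landau–Siegel zeros, Theorems 1–2
of arXiv:2211.02515 or a repaired Margin232 until a kernel theorem says so.»

## References

* [ConreyIwaniec2002] B. Conrey, H. Iwaniec, Acta Arith. 103 (2002) 259–312, arXiv:math/0111012:
  §6 (6.38), (6.42)–(6.50), Corollary 6.3 (6.49), Proposition 6.4 (6.52); §7 (7.1)–(7.3), (7.6),
  Proposition 7.1 (7.12)–(7.13), (7.19)–(7.20), (7.26), Lemma 7.5 (7.28); §8 (8.1)–(8.4), (8.8),
  Proposition 8.1 (8.10); §9 (9.3), (9.5)–(9.6), Proposition 9.1 (9.7).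
* Tree: `ConreyIwaniec2002.lean` (§§1, 10; `dividedDifference`, `IsPointSet`),
  `ConreyIwaniec2002MeanValues.lean` (Proposition 9.2), `ClassGroupCharacterTwist.lean` /
  `TwistedDedekindCoefficients.lean` (`twistCount`, `twistMoebius`, `classGroupCharIdealHom`),
  `RamanujanDivisorSquare.lean` (`divisorSumChar`), `UniformClassGroupPNT.lean`
  (`classGroupLFunction`).
-/

noncomputable section

open scoped NumberField
open Complex

namespace Literature.NumberTheory.LFunctions

namespace ConreyIwaniec2002

open NumberField

/-! ### Vocabulary of §§6–9 -/

/-- **`Q = √q/2π`**, the conductor parameter of the completed `L`-function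
`Λ(s) = Q^s Γ(s) L(s)` of a class group character of `ℚ(√−q)`.
[cite: ConreyIwaniec2002, §7 (7.6)] -/
def condQ (q : ℕ) : ℝ :=
  Real.sqrt q / (2 * Real.pi)

/-- **`X(s) = Q^{1−2s} Γ(1−s)/Γ(s)`**, the root-number factor of the approximate functional
equation (7.12) (`Λ(s) = Λ(1−s)`, root number `1`). [cite: ConreyIwaniec2002, Proposition 7.1 (7.13)] -/
def afeX (q : ℕ) (s : ℂ) : ℂ :=
  (condQ q : ℂ) ^ (1 - 2 * s) * Complex.Gamma (1 - s) / Complex.Gamma s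

/-- **`x(s) = (X(s) − X(s′))/(s − s′)`** (7.20), with the same convention as `ℓ(s)`: the derivative
`X′(s)` when the companion `s′` coincides with `s` (the tree's generic `dividedDifference`).
[cite: ConreyIwaniec2002, §7 (7.20)] -/
def xQuot (q : ℕ) (s s' : ℂ) : ℂ :=
  dividedDifference (afeX q) s s'

/-- **`ℒ(Y) = L(1,χ)(L(1,χ) log Y + |L′(1,χ)|)`** (6.50) — the quantity that is small when `L(1,χ)`
is small and that controls every diagonal term of §§6–9. (`L(1,χ) > 0` for the real character
`χ`; rendered with norms.) [cite: ConreyIwaniec2002, Corollary 6.3 (6.50)] -/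
def calL {q : ℕ} [NeZero q] (χ : DirichletCharacter ℂ q) (Y : ℝ) : ℝ :=
  ‖χ.LFunction 1‖ * (‖χ.LFunction 1‖ * Real.log Y + ‖deriv χ.LFunction 1‖)

variable (K : Type) [Field K] [NumberField K]

/-- **`N(s) = Σ_{n ≤ q⁴} λ(n) n^{−s}`** (8.8), `λ(n) = Σ_{N𝔞 = n} ψ(𝔞)` (7.1) the coefficients of
`L(s,ψ)` (the tree's `twistCount K (classGroupCharIdealHom ψ)`).
[cite: ConreyIwaniec2002, §8 (8.8)] -/
def shortLSum (ψ : ClassGroup (𝓞 K) →* ℂˣ) (q : ℕ) (s : ℂ) : ℂ :=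
  ∑ n ∈ Finset.Icc 1 (q ^ 4), twistCount K (classGroupCharIdealHom ψ) n * (n : ℂ) ^ (-s)

/-- **`M(s) = Σ_{m ≤ q⁴} λ*(m) m^{−s}`** (9.5), `λ*(m) = Σ_{N𝔞 = m} μ(𝔞)ψ(𝔞)` (9.3) the
coefficients of `L(s,ψ)^{−1}` (the tree's `twistMoebius K (classGroupCharIdealHom ψ)`).
[cite: ConreyIwaniec2002, §9 (9.5)] -/
def shortInvSum (ψ : ClassGroup (𝓞 K) →* ℂˣ) (q : ℕ) (s : ℂ) : ℂ :=
  ∑ m ∈ Finset.Icc 1 (q ^ 4), twistMoebius K (classGroupCharIdealHom ψ) m * (m : ℂ) ^ (-s)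

/-- **`D(T) = Σ_s |ℓ(s) − x(s) N̄(s)|²`** of Proposition 8.1, the sum over the points `s = ½ + it`,
`t ∈ S`, with companions `s′ = ½ + it′(t)`; `ℓ(s) = (L(s,ψ) − L(s′,ψ))/(s − s′)` (7.19).
[cite: ConreyIwaniec2002, Proposition 8.1] -/
def defectD (ψ : ClassGroup (𝓞 K) →* ℂˣ) (q : ℕ) (S : Finset ℝ) (t' : ℝ → ℝ) : ℝ :=
  ∑ t ∈ S, ‖dividedDifference (classGroupLFunction K ψ) (1 / 2 + t * I) (1 / 2 + t' t * I) -
      xQuot q (1 / 2 + t * I) (1 / 2 + t' t * I) *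
        starRingEnd ℂ (shortLSum K ψ q (1 / 2 + t * I))‖ ^ 2

/-- **`E(T) = Σ_s |ℓ(s) M̄(s) − x(s)|`** (9.6), the sum over the points `s = ½ + it`, `t ∈ S`, with
companions `s′ = ½ + it′(t)`. [cite: ConreyIwaniec2002, §9 (9.6)] -/
def defectE (ψ : ClassGroup (𝓞 K) →* ℂˣ) (q : ℕ) (S : Finset ℝ) (t' : ℝ → ℝ) : ℝ :=
  ∑ t ∈ S, ‖dividedDifference (classGroupLFunction K ψ) (1 / 2 + t * I) (1 / 2 + t' t * I) *
        starRingEnd ℂ (shortInvSum K ψ q (1 / 2 + t * I)) -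
      xQuot q (1 / 2 + t * I) (1 / 2 + t' t * I)‖

variable {K}

/-- **The point sets `S(T)` of §8**: `s_r = ½ + it_r` with `T < t₁ < … < t_R ≤ 2T` (8.2) and
`t_{r+1} − t_r ≥ 1` (8.3) — a finite set of reals in `(T, 2T]`, pairwise at distance `≥ 1`.
[cite: ConreyIwaniec2002, §8 (8.1)–(8.3)] -/
def IsDyadicPointSet (S : Finset ℝ) (T : ℝ) : Prop :=
  (∀ t ∈ S, T < t ∧ t ≤ 2 * T) ∧ ∀ t ∈ S, ∀ u ∈ S, t ≠ u → 1 ≤ |t - u|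

/-- **The cut-off class (6.38)**: `a` of class `𝒞²` on `ℝ⁺` with
`y^ν |a^{(ν)}(y)| ≤ (1 + y/Y + T/y)^{−4}` for `ν = 0, 1, 2` (a smooth weight localising `n`
between `T` and `Y`). [cite: ConreyIwaniec2002, Corollary 6.2 (6.38)] -/
def IsCutoff (a : ℝ → ℂ) (T Y : ℝ) : Prop :=
  ContDiffOn ℝ 2 a (Set.Ioi 0) ∧
    ∀ ν : ℕ, ν ≤ 2 → ∀ y : ℝ, 0 < y →
      y ^ ν * ‖iteratedDeriv ν a y‖ ≤ ((1 + y / Y + T / y) ^ 4)⁻¹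

/-! ### API (proved) -/

/-- `Q = √q/2π > 0` for `q ≥ 1`. [cite: ConreyIwaniec2002, §7 (7.6)] -/
theorem condQ_pos {q : ℕ} (hq : 0 < q) : 0 < condQ q := by
  unfold condQ
  have : 0 < Real.sqrt q := Real.sqrt_pos.mpr (by exact_mod_cast hq)
  positivity

/-- **`|X(s)| = 1` on the critical line** ("`|X(s)| = 1` for `Re s = ½`", before (7.26)):
`|Q^{−2it}| = 1` and `Γ(½ − it) = conj Γ(½ + it)`. [cite: ConreyIwaniec2002, §7 (7.26)] -/
theorem norm_afeX_half (q : ℕ) (hq : 0 < q) (t : ℝ) : ‖afeX q (1 / 2 + t * I)‖ = 1 := by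
  have hQ : 0 < condQ q := condQ_pos hq
  set s : ℂ := 1 / 2 + t * I with hs
  have hre : s.re = 1 / 2 := by simp [hs]
  have hconj : 1 - s = starRingEnd ℂ s := by
    apply Complex.ext <;> norm_num [hs]
  have hΓ : Complex.Gamma s ≠ 0 :=
    Complex.Gamma_ne_zero_of_re_pos (by rw [hre]; norm_num)
  have h1 : ‖(condQ q : ℂ) ^ (1 - 2 * s)‖ = 1 := by
    rw [Complex.norm_cpow_eq_rpow_re_of_pos hQ]
    have : (1 - 2 * s).re = 0 := by simp [hs]
    rw [this, Real.rpow_zero]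
  have h2 : ‖Complex.Gamma (1 - s)‖ = ‖Complex.Gamma s‖ := by
    rw [hconj, Complex.Gamma_conj, Complex.norm_conj]
  unfold afeX
  rw [norm_div, norm_mul, h1, h2, one_mul, div_self (norm_ne_zero_iff.mpr hΓ)]

/-- `x(s)` at a coincident companion is the derivative `X′(s)`. [cite: ConreyIwaniec2002, §7 (7.20)] -/
@[simp] theorem xQuot_self (q : ℕ) (s : ℂ) : xQuot q s s = deriv (afeX q) s := by
  simp [xQuot]

/-- For distinct points `x(s)` is the difference quotient of `X`. [cite: ConreyIwaniec2002, §7 (7.20)] -/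
theorem xQuot_of_ne (q : ℕ) {s s' : ℂ} (h : s' ≠ s) :
    xQuot q s s' = (afeX q s - afeX q s') / (s - s') :=
  dividedDifference_of_ne _ h

/-- `ℒ(Y) ≥ 0` for `Y ≥ 1`. [cite: ConreyIwaniec2002, Corollary 6.3 (6.50)] -/
theorem calL_nonneg {q : ℕ} [NeZero q] (χ : DirichletCharacter ℂ q) {Y : ℝ} (hY : 1 ≤ Y) :
    0 ≤ calL χ Y := by
  unfold calL
  have := Real.log_nonneg hY
  positivity

/-- `D(T) ≥ 0`. [cite: ConreyIwaniec2002, Proposition 8.1] -/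
theorem defectD_nonneg (ψ : ClassGroup (𝓞 K) →* ℂˣ) (q : ℕ) (S : Finset ℝ) (t' : ℝ → ℝ) :
    0 ≤ defectD K ψ q S t' :=
  Finset.sum_nonneg fun _ _ => by positivity

/-- `E(T) ≥ 0`. [cite: ConreyIwaniec2002, §9 (9.6)] -/
theorem defectE_nonneg (ψ : ClassGroup (𝓞 K) →* ℂˣ) (q : ℕ) (S : Finset ℝ) (t' : ℝ → ℝ) :
    0 ≤ defectE K ψ q S t' :=
  Finset.sum_nonneg fun _ _ => norm_nonneg _

/-- A point of a dyadic point set lies in `(T, 2T]`. [cite: ConreyIwaniec2002, §8 (8.2)] -/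
theorem IsDyadicPointSet.mem_bounds {S : Finset ℝ} {T : ℝ} (h : IsDyadicPointSet S T) {t : ℝ}
    (ht : t ∈ S) : T < t ∧ t ≤ 2 * T :=
  h.1 t ht

/-- **A dyadic point set of §8 is a point set of Proposition 10.1** in `[2, 2T]` once `T ≥ 2`.
[cite: ConreyIwaniec2002, §8 (8.1)–(8.3)] -/
theorem IsDyadicPointSet.isPointSet {S : Finset ℝ} {T : ℝ} (hT : 2 ≤ T)
    (h : IsDyadicPointSet S T) : IsPointSet S (2 * T) :=
  ⟨fun t ht => ⟨by linarith [(h.1 t ht).1], (h.1 t ht).2⟩, h.2⟩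

/-- Subsets of dyadic point sets are dyadic point sets. [cite: ConreyIwaniec2002, §8 (8.1)–(8.3)] -/
theorem IsDyadicPointSet.subset {S S' : Finset ℝ} {T : ℝ} (hSS' : S' ⊆ S)
    (h : IsDyadicPointSet S T) : IsDyadicPointSet S' T :=
  ⟨fun t ht => h.1 t (hSS' ht), fun t ht u hu => h.2 t (hSS' ht) u (hSS' hu)⟩

/-- The empty set is a dyadic point set. [cite: ConreyIwaniec2002, §8 (8.1)–(8.3)] -/
@[simp] theorem isDyadicPointSet_empty (T : ℝ) : IsDyadicPointSet ∅ T := by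
  simp [IsDyadicPointSet]

/-- The bound (6.38) at order `0`: `‖a(y)‖ ≤ (1 + y/Y + T/y)^{−4} ≤ 1`.
[cite: ConreyIwaniec2002, Corollary 6.2 (6.38)] -/
theorem IsCutoff.norm_le_one {a : ℝ → ℂ} {T Y : ℝ} (h : IsCutoff a T Y) (hT : 0 ≤ T) (hY : 0 ≤ Y)
    {y : ℝ} (hy : 0 < y) : ‖a y‖ ≤ 1 := by
  have h0 := h.2 0 (by norm_num) y hy
  simp only [pow_zero, iteratedDeriv_zero, one_mul] at h0
  refine h0.trans ?_
  have h1 : 1 ≤ 1 + y / Y + T / y := by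
    have : 0 ≤ y / Y := div_nonneg hy.le hY
    have : 0 ≤ T / y := div_nonneg hT hy.le
    linarith
  have h4 : 1 ≤ (1 + y / Y + T / y) ^ 4 := one_le_pow₀ h1
  exact inv_le_one_of_one_le₀ h4

end ConreyIwaniec2002

open ConreyIwaniec2002 NumberField

/-! ### The named facts -/

/-- **Conrey–Iwaniec 2002, Corollary 6.3.** "For `Y ≥ 2X ≥ 2` we have
`Σ_{X ≤ n ≤ Y} τ²(n,χ) n^{−1} ≪ ℒ(Y) log(Y/X) + (q/X)^{1/2}` (6.49) where
`ℒ(Y) = L(1,χ)(L(1,χ) log Y + |L′(1,χ)|)` (6.50)." Here `K = ℚ(√−q)`, `χ` the real primitive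
character mod `q` (`−q` a fundamental discriminant, `q > 4` as in §1), `τ(n,χ) = Σ_{d∣n} χ(d)` the
coefficients of `ζ_K = ζ·L(·,χ)` ((6.42)–(6.43); the tree's `divisorSumChar`); the implied constant
is absolute (from (6.48): `R_K(s) ≪ q^{1/2}|s|^{5/6}` on `Re s ≥ ½`). The lacunarity of the
divisor sums of an exceptional character in mean square: the right side is small when `L(1,χ)` is.
Rendered with ONE absolute `C > 0` outermost, the sum over the integers `⌈X⌉ ≤ n ≤ ⌊Y⌋`. NAMED
FACT, not proved here (it rests on (6.43)–(6.48), contour integration against `R_K(s+1)`).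
[cite: ConreyIwaniec2002, Corollary 6.3] -/
def conreyIwaniec2002_corollary63 : Prop :=
  ∃ C : ℝ, 0 < C ∧
    ∀ (q : ℕ) [NeZero q], 4 < q → ∀ χ : DirichletCharacter ℂ q,
      χ.IsPrimitive → χ.IsQuadratic → χ.Odd →
        ∀ X Y : ℝ, 1 ≤ X → 2 * X ≤ Y →
          ∑ n ∈ Finset.Icc ⌈X⌉₊ ⌊Y⌋₊, ‖divisorSumChar χ n‖ ^ 2 / (n : ℝ) ≤
            C * (calL χ Y * Real.log (Y / X) + Real.sqrt (q / X))

/-- **Conrey–Iwaniec 2002, Proposition 6.4** (the case of class group characters, used in §§8–9).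
"Let `λ(n)` be the coefficients of an automorphic form given by Hecke characters of the imaginary
quadratic field `K = ℚ(√−q)` of discriminant `−q`. Let `a(y)` be a function satisfying (6.38) with
`Y = qT` and `T ≥ K^{32} q^{65}`. Then `∫_T^{2T} |Σ_n a(n)λ(n) n^{−1/2−it}|² dt ≪ T ℒ(T) log q`
(6.52) where `ℒ(T)` is defined by (6.50) and the implied constant is absolute." (6.38):
`y^ν|a^{(ν)}(y)| ≤ (1 + y/Y + T/y)^{−4}`, `ν = 0,1,2`, `a ∈ 𝒞²(ℝ⁺)`. Typed for `λ = λ_ψ`,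
`ψ ∈ Ĉℓ(K)` (weight-one theta series, so the threshold `K^{32}q^{65}` — `K` = the weight — reads
`T ≥ q^{65}`, the form in which §8 invokes it, p. 18: "we assume that `T ≥ q^{65}` to comply with
the condition of Proposition 6.4"), under §7's standing data (`q` odd, `q > 4`, `−q` fundamental);
`λ_ψ(n)` = the tree's `twistCount K (classGroupCharIdealHom ψ) n`, the series = Mathlib's `LSeries`
at `½ + it`. Rendered with ONE absolute `C > 0` outermost. NAMED FACT, not proved here (it rests on
Theorem 6.1, Corollary 6.2, Theorem 4.3/4.4).
`-- TODO(general form): Hecke Grössencharacters of weight k ≥ 1 of K, threshold T ≥ k^{32} q^{65}.`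
[cite: ConreyIwaniec2002, Proposition 6.4] -/
def conreyIwaniec2002_proposition64 : Prop :=
  ∃ C : ℝ, 0 < C ∧
    ∀ (q : ℕ) [NeZero q], 4 < q → Odd q → ∀ χ : DirichletCharacter ℂ q,
      χ.IsPrimitive → χ.IsQuadratic → χ.Odd →
        ∀ (K : Type) [Field K] [NumberField K],
          Module.finrank ℚ K = 2 → NumberField.discr K = -(q : ℤ) →
            ∀ (ψ : ClassGroup (𝓞 K) →* ℂˣ) (T : ℝ) (a : ℝ → ℂ),
              (q : ℝ) ^ (65 : ℕ) ≤ T → IsCutoff a T (q * T) →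
                ∫ t in T..2 * T,
                    ‖LSeries (fun n ↦ a n * twistCount K (classGroupCharIdealHom ψ) n)
                      (1 / 2 + t * I)‖ ^ 2 ≤
                  C * (T * calL χ T * Real.log q)

/-- **Conrey–Iwaniec 2002, Proposition 8.1.** "Let `S(T)` be a set of points satisfying
(8.1)–(8.3) with `T ≥ 2`. Put `D(T) = Σ_s |ℓ(s) − x(s)N̄(s)|²` where `s` runs over `S(T)` (recall
the settings (7.19), (7.20), (8.8)). We have `D(T) ≪ T(log q)^7 + T ℒ(T)(log T)^4` (8.10) where
`ℒ(T)` is defined by (6.50), the implied constant being absolute." Standing data of §7: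
`K = ℚ(√−q)`, `−q` the discriminant, **`q` odd**, `q > 4`, `ψ ∈ Ĉℓ(K)`, `L(s) = L(s,ψ)`;
`ℓ(s) = (L(s) − L(s′))/(s − s′)` (`L′(s)` if `s′ = s`), `x(s) = (X(s) − X(s′))/(s − s′)`,
`X(s) = Q^{1−2s}Γ(1−s)/Γ(s)`, `Q = √q/2π`, `N(s) = Σ_{n ≤ q⁴} λ(n)n^{−s}`; points `s = ½ + it`,
`T < t ≤ 2T`, `1`-spaced (`IsDyadicPointSet`), companions `s′ = ½ + it′` unrestricted (8.4).
"`x(s)N̄(s)` approximates to `ℓ(s)` at almost all points `s` in any well-spaced set `S(T)`" when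
`L(1,χ)` is small relative to `log T`. Rendered with ONE absolute `C > 0` outermost. NAMED FACT,
not proved here (it rests on (7.23), Lemmas 5.3/7.2–7.4, Propositions 5.4/6.4, Corollary 6.3).
[cite: ConreyIwaniec2002, Proposition 8.1] -/
def conreyIwaniec2002_proposition81 : Prop :=
  ∃ C : ℝ, 0 < C ∧
    ∀ (q : ℕ) [NeZero q], 4 < q → Odd q → ∀ χ : DirichletCharacter ℂ q,
      χ.IsPrimitive → χ.IsQuadratic → χ.Odd →
        ∀ (K : Type) [Field K] [NumberField K],
          Module.finrank ℚ K = 2 → NumberField.discr K = -(q : ℤ) →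
            ∀ (ψ : ClassGroup (𝓞 K) →* ℂˣ) (T : ℝ) (S : Finset ℝ) (t' : ℝ → ℝ),
              2 ≤ T → IsDyadicPointSet S T →
                defectD K ψ q S t' ≤
                  C * (T * Real.log q ^ (7 : ℕ) + T * calL χ T * Real.log T ^ (4 : ℕ))

/-- **Conrey–Iwaniec 2002, Proposition 9.1.** "Let `S(T)` be a set of points satisfying
(8.1)–(8.3) with `T ≥ 2`. Then `E(T) ≪ T(log q)^6 + T ℒ(T)^{1/2}(log T)²(log q)^{5/2}` (9.7) where
the implied constant is absolute"; `E(T) = Σ_s |ℓ(s)M̄(s) − x(s)|` (9.6),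
`M(s) = Σ_{m ≤ q⁴} λ*(m)m^{−s}` (9.5), `λ*(m) = Σ_{N𝔞=m} μ(𝔞)ψ(𝔞)` the coefficients of
`L(s,ψ)^{−1}` (9.3); same standing data and conventions as Proposition 8.1 (**`q` odd**).
"Assuming that `L(1,χ)` is relatively small Proposition 9.1 asserts that `ℓ(s)M̄(s)` approximates
to `x(s)` at almost all points `s` in any well-spaced set `S(T)` … if `ℓ(s)` is very small …
`x(s)` is also quite small" — and `|x(s)| = 2|sin((t−t′)log tQ)/(t−t′)| + O(1/t)` (Lemma 7.5):
the `t`-averaged picket fence. Rendered with ONE absolute `C > 0` outermost, `ℒ(T)^{1/2}` as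
`Real.sqrt`, `(log q)^{5/2}` as `Real.rpow`. NAMED FACT, not proved here (it rests on Proposition
8.1 and Corollary 6.3). [cite: ConreyIwaniec2002, Proposition 9.1] -/
def conreyIwaniec2002_proposition91 : Prop :=
  ∃ C : ℝ, 0 < C ∧
    ∀ (q : ℕ) [NeZero q], 4 < q → Odd q → ∀ χ : DirichletCharacter ℂ q,
      χ.IsPrimitive → χ.IsQuadratic → χ.Odd →
        ∀ (K : Type) [Field K] [NumberField K],
          Module.finrank ℚ K = 2 → NumberField.discr K = -(q : ℤ) →
            ∀ (ψ : ClassGroup (𝓞 K) →* ℂˣ) (T : ℝ) (S : Finset ℝ) (t' : ℝ → ℝ),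
              2 ≤ T → IsDyadicPointSet S T →
                defectE K ψ q S t' ≤
                  C * (T * Real.log q ^ (6 : ℕ) +
                    T * Real.sqrt (calL χ T) * Real.log T ^ (2 : ℕ) * Real.log q ^ ((5 : ℝ) / 2))

/-! ### Bookkeeping (proved) -/

/-- **Proposition 8.1 restricted to a sub-family of points**: the bound for `S(T)` bounds `D` on
every subset (the defect is a sum of non-negative terms) — the form in which "almost all points"
statements are extracted. [cite: ConreyIwaniec2002, Proposition 8.1] -/
theorem ConreyIwaniec2002.defectD_mono {K : Type} [Field K] [NumberField K]
    (ψ : ClassGroup (𝓞 K) →* ℂˣ) (q : ℕ) {S S' : Finset ℝ} (hSS' : S' ⊆ S) (t' : ℝ → ℝ) :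
    defectD K ψ q S' t' ≤ defectD K ψ q S t' :=
  Finset.sum_le_sum_of_subset_of_nonneg hSS' fun _ _ _ => by positivity

/-- The same monotonicity for `E(T)`. [cite: ConreyIwaniec2002, §9 (9.6)] -/
theorem ConreyIwaniec2002.defectE_mono {K : Type} [Field K] [NumberField K]
    (ψ : ClassGroup (𝓞 K) →* ℂˣ) (q : ℕ) {S S' : Finset ℝ} (hSS' : S' ⊆ S) (t' : ℝ → ℝ) :
    defectE K ψ q S' t' ≤ defectE K ψ q S t' :=
  Finset.sum_le_sum_of_subset_of_nonneg hSS' fun _ _ _ => norm_nonneg _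

/-- **"At almost all points": Chebyshev's count from Proposition 8.1.** If `D ≤ B` then the
points where `|ℓ(s) − x(s)N̄(s)| ≥ δ` number at most `B/δ²`. Elementary (Markov's inequality on a
finite sum); the quantitative content of "`x(s)N̄(s)` approximates to `ℓ(s)` at almost all points".
[cite: ConreyIwaniec2002, Proposition 8.1 (after (8.10))] -/
theorem ConreyIwaniec2002.card_filter_defect_ge_le {K : Type} [Field K] [NumberField K]
    (ψ : ClassGroup (𝓞 K) →* ℂˣ) (q : ℕ) (S : Finset ℝ) (t' : ℝ → ℝ) {B δ : ℝ} (hδ : 0 < δ)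
    (hD : defectD K ψ q S t' ≤ B) :
    ((S.filter fun t : ℝ => δ ≤
        ‖dividedDifference (classGroupLFunction K ψ) (1 / 2 + t * I) (1 / 2 + t' t * I) -
          xQuot q (1 / 2 + t * I) (1 / 2 + t' t * I) *
            starRingEnd ℂ (shortLSum K ψ q (1 / 2 + t * I))‖).card : ℝ) ≤ B / δ ^ 2 := by
  classical
  set S' := S.filter fun t : ℝ => δ ≤
        ‖dividedDifference (classGroupLFunction K ψ) (1 / 2 + t * I) (1 / 2 + t' t * I) -
          xQuot q (1 / 2 + t * I) (1 / 2 + t' t * I) *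
            starRingEnd ℂ (shortLSum K ψ q (1 / 2 + t * I))‖ with hS'
  have hsub : S' ⊆ S := Finset.filter_subset _ _
  have h1 : (S'.card : ℝ) * δ ^ 2 ≤ defectD K ψ q S' t' := by
    unfold defectD
    rw [Finset.card_eq_sum_ones, Nat.cast_sum, Finset.sum_mul]
    refine Finset.sum_le_sum fun t ht => ?_
    have hge := (Finset.mem_filter.mp ht).2
    simp only [Nat.cast_one, one_mul]
    exact pow_le_pow_left₀ hδ.le hge 2
  have h2 : defectD K ψ q S' t' ≤ B := (defectD_mono ψ q hsub t').trans hD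
  rw [le_div_iff₀ (pow_pos hδ 2)]
  exact h1.trans h2

end Literature.NumberTheory.LFunctions

end
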